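import Literature.Analysis.FluidPDE.QuasiSelfSimilarMoveSP01
import HarnessLib

/-!
# Straight move, phase 1: re-description certificates towards phase 2

Topic `Literature/Analysis/FluidPDE`. Emitted data / kernel certificates of the explicit straight generating
move (`S`) in the typed-chain model, under the contract of `PlanarGeneratorAssembly.lean`
(`acm_compatible_blocks_of_slots`). Generated by the author's emitter from the exact rational design;
no named facts, every theorem is decided in the kernel or assembled from decided chunks. [folklore]

## References

* G. Alberti, G. Crippa, A. L. Mazzucato, *Exponential self-similar mixing by incompressible
  flows*, J. Amer. Math. Soc. 32 (2019), 445–490, §8 (arXiv:1605.02090).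
-/

noncomputable section

namespace Literature.Analysis.FluidPDE.QuasiSelfSimilar.MoveS

open PlanarKinematics QuasiSelfSimilar

/-- Cover certificate of the end keyframe of phase 1 by the start keyframe of phase 2. [folklore] -/
def rc01 : List (Fin 2 × List (ℕ × EquivCert)) := [(0, [(0, .same)]), (0, [(1, .same)]), (0, [(2, .same)]), (0, [(3, .same)]), (1, [(4, .same), (5, (.gap 1 0 0 0 (mkRat (6181) 9000) (mkRat (251) 360)))]), (1, [(4, (.gap 0 0 1 0 (mkRat (6181) 9000) (mkRat (251) 360))), (5, .same)]), (0, [(6, .same)]), (0, [(7, .same)]), (0, [(8, .same)]), (1, [(10, (.gap 1 0 0 0 (mkRat (-7) 72) (mkRat (-781) 9000))), (9, .same)]), (1, [(10, .same), (9, (.gap 0 0 1 0 (mkRat (-7) 72) (mkRat (-781) 9000)))]), (0, [(11, .same)]), (0, [(12, .same)]), (0, [(13, .same)]), (1, [(15, (.gap 1 0 0 0 (mkRat (781) 9000) (mkRat (7) 72))), (14, .same)]), (1, [(15, .same), (14, (.gap 0 0 1 0 (mkRat (781) 9000) (mkRat (7) 72)))]), (0, [(16, .same)]), (0, [(17, .same)]),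 (0, [(18, .same)]), (1, [(19, .same), (20, (.gap 1 0 0 0 (mkRat (469) 360) (mkRat (11819) 9000)))]), (1, [(19, (.gap 0 0 1 0 (mkRat (469) 360) (mkRat (11819) 9000))), (20, .same)]), (0, [(21, .same)]), (0, [(22, .same)]), (0, [(23, .same)]), (0, [(24, .same)])]

/-- Cover certificate of the start keyframe of phase 2 by the end keyframe of phase 1. [folklore] -/
def rc01' : List (Fin 2 × List (ℕ × EquivCert)) := [(0, [(0, .same)]), (0, [(1, .same)]), (0, [(2, .same)]), (0, [(3, .same)]), (0, [(4, .same), (5, (.gap 1 0 0 0 (mkRat (6181) 9000) (mkRat (251) 360)))]), (0, [(4, (.gap 0 0 1 0 (mkRat (6181) 9000) (mkRat (251) 360))), (5, .same)]), (0, [(6, .same)]), (0, [(7, .same)]), (0, [(8, .same)]), (0, [(9, .same), (10, (.gap 1 0 0 0 (mkRat (-7) 72) (mkRat (-781) 9000)))]), (0, [(9, (.gap 0 0 1 0 (mkRat (-7) 72) (mkRat (-781) 9000))), (10, .same)]), (0, [(11, .same)]), (0, [(12, .same)]), (0, [(13, .same)]), (0, [(14, .same), (15, (.gap 1 0 0 0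 (mkRat (781) 9000) (mkRat (7) 72)))]), (0, [(14, (.gap 0 0 1 0 (mkRat (781) 9000) (mkRat (7) 72))), (15, .same)]), (0, [(16, .same)]), (0, [(17, .same)]), (0, [(18, .same)]), (0, [(19, .same), (20, (.gap 1 0 0 0 (mkRat (469) 360) (mkRat (11819) 9000)))]), (0, [(19, (.gap 0 0 1 0 (mkRat (469) 360) (mkRat (11819) 9000))), (20, .same)]), (0, [(21, .same)]), (0, [(22, .same)]), (0, [(23, .same)]), (0, [(24, .same)])]

end Literature.Analysis.FluidPDE.QuasiSelfSimilar.MoveS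

end
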